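import Literature.NumberTheory.Transcendental.RoyRankGenericPhi
import Literature.Barriers.Schanuel.AlgebraicIndependenceOfLogarithmsThm4FromThm2C
import HarnessLib

/-!
# Roy 1992 over a general field: conditions (4) and (5) of p. 35

Support file (everything proved, no facts) for the deduction of Roy's Theorem 4 from his Theorem 2
over the general data `(K, F, L)` of `Literature.NumberTheory.Transcendental.RoyRankGenericDefs`
([Roy1992], §4 pp. 34–36, generality of Remark (i) p. 37); field-generic form of the `K = ℂ`
companion `Literature.Barriers.Schanuel.AlgebraicIndependenceOfLogarithmsThm4FromThm2C` (whose
real-number lemma `Roy1992.key_ineq` is reused by import). In the case `d' = d` of the printed proof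
one has the minimality property

  (2) `dim_K(t₁(U))/d₁ ≥ dim_K(U)/d` for each surjective `K`-linear `t₁ : K^d → K^{d₁}` rational
      over `F` and non-zero (`RoyRank.IsMinimalTwo F d U`),

and Theorem 2 is applied to the object `(K^d × (K^d)^m, Y, W, V)`, `V = φ⁻¹(U)`, with the identity
as the chosen map: "Let us show that we can choose the identity mapping of `K^d × (K^d)^m` to apply
this theorem. This amounts on the one hand to showing (4) `V ∩ (ℚ̄^d × 0) = 0`, and on the other
hand to showing (5) `md/(d + md − dim_K(V)) ≤ d₁'/(d₀' + d₁' − dim_K(s(V)))` for each surjective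
`K`-linear mapping `s : K^d × (K^d)^m → K^{d₀'} × K^{d₁'}` satisfying `s(ℚ̄^d × 0) ⊆ ℚ̄^{d₀'} × 0`,
`s(0 × (ℚ^d)^m) ⊆ 0 × ℚ^{d₁'}`, `s(V) ≠ K^{d₀'} × K^{d₁'}`" [Roy1992, p. 35]. This file proves both
from (2):

* `RoyRank.fPoints_eq_bot_of_minimal` — (4) in the form `U ∩ F^d = 0` (p. 36: with
  `T = K·(U ∩ ℚ̄^d) ⊆ U` and `t₁` a rational surjection with kernel `T`, "(2) applied to this
  choice of `t₁` gives `dim_K(T) = 0`").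
* `RoyRank.thm2Ratio_id_le` — (5), following pp. 35–36: `ker s = S₀ × S₁`
  (`exists_eq_prodMap_of_isAdmissible`); `T = φ(S₀ × S₁)` is rational over `F`
  (`RoyRank.map_phi_prod_eq_spanK`); `t₁` = a rational surjection with kernel `T`; the count
  "`dim_K(S₁) = dim_ℚ(S) = dim_ℚ(φ(0 × S)) ≤ m dim_k(T ∩ k^d) ≤ m dim_K(T)`, whence
  `d₁' ≥ m(d − dim_K(T)) = md₁`" (`RoyRank.finrank_le_mul_finrank_of_psi_mem`); and the identities
  (6) `d + md − dim_K(V) = d − dim_K(U)`, `d₀' + d₁' − dim_K(s(V)) = d₁ − dim_K(t₁(U))`.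

## References

* [Roy1992] D. Roy, *Matrices whose coefficients are linear forms in logarithms*, J. Number Theory
  41 (1992) 22–47: §4, proof of Theorem 4, (2), (4), (5), (6), pp. 34–36; Remark (i), p. 37.
-/

noncomputable section

open Module Submodule
open Literature.Barriers.Schanuel.Roy1992 (incl incl_apply spanK fPoints mem_fPoints spanK_span
  spanK_fPoints_le finrank_spanK exists_surjective_ker_eq_spanK ker_mulVecLin_map psi psi_apply
  finrank_map_add_finrank_ker finrank_comap_of_surjective finrank_prod_eq comap_sup_eq_comap key_ineq)

namespace Literature.NumberTheory.Transcendental.RoyRank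

variable {K : Type*} [Field K] [CharZero K]
variable {F : IntermediateField ℚ K} {L : Submodule ℚ K}
variable {d : ℕ}

/-! ### (4): `U` has no non-zero `F`-points -/

/-- **(4) `U ∩ F^d = 0`**: if `U ≠ K^d` satisfies the minimality (2) then `U` contains no non-zero
vector with coordinates in `F` (p. 36: with `T = K·(U ∩ ℚ̄^d) ⊆ U` and `t₁` a rational surjection
with kernel `T`, (2) gives `dim_K(T) = 0`). [cite: Roy1992, §4 proof of Theorem 4, (4) (p. 36)] -/
theorem fPoints_eq_bot_of_minimal (hd : 0 < d) {U : Submodule K (Fin d → K)} (hU : U ≠ ⊤)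
    (hmin : IsMinimalTwo F d U) : fPoints (F := F) U = ⊥ := by
  by_contra hne
  have hτ0 : 0 < finrank F (fPoints (F := F) U) := by
    rw [pos_iff_ne_zero, Ne, Submodule.finrank_eq_zero]
    exact hne
  obtain ⟨d₁, A, hdim, hsurj, hker⟩ := exists_surjective_ker_eq_spanK (K := K) (fPoints (F := F) U)
  have hTU : LinearMap.ker (A.map (algebraMap F K)).mulVecLin ≤ U := by
    rw [hker]; exact spanK_fPoints_le U
  have hTfin : finrank K (LinearMap.ker (A.map (algebraMap F K)).mulVecLin) =
      finrank F (fPoints (F := F) U) := by rw [hker, finrank_spanK]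
  have hu : finrank K U < d := by
    have := Submodule.finrank_lt hU
    simpa using this
  have hτu : finrank F (fPoints (F := F) U) ≤ finrank K U := hTfin ▸ Submodule.finrank_mono hTU
  have hd₁ : 0 < d₁ := by omega
  have hmap : finrank K (U.map (A.map (algebraMap F K)).mulVecLin) +
      finrank F (fPoints (F := F) U) = finrank K U := by
    rw [← hTfin, finrank_map_add_finrank_ker, sup_eq_left.2 hTU]
  have h := hmin d₁ _ hsurj (isRationalMap_mulVecLin_map F A) (ne_zero_of_surjective hd₁ hsurj)
  have hd₁' : (d₁ : ℝ) = d - finrank F (fPoints (F := F) U) := by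
    have : (d₁ : ℝ) + finrank F (fPoints (F := F) U) = d := by exact_mod_cast hdim
    linarith
  have hmap' : (finrank K (U.map (A.map (algebraMap F K)).mulVecLin) : ℝ) =
      finrank K U - finrank F (fPoints (F := F) U) := by
    have : (finrank K (U.map (A.map (algebraMap F K)).mulVecLin) : ℝ) +
        finrank F (fPoints (F := F) U) = finrank K U := by exact_mod_cast hmap
    linarith
  rw [hd₁', hmap'] at h
  have hdR : (0 : ℝ) < d := by exact_mod_cast hd
  have hτR : (finrank F (fPoints (F := F) U) : ℝ) < d := by
    exact_mod_cast (lt_of_le_of_lt hτu hu)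
  have hk := key_ineq hdR hτR h
  have hτpos : (0 : ℝ) < finrank F (fPoints (F := F) U) := by exact_mod_cast hτ0
  have huR : (finrank K U : ℝ) < d := by exact_mod_cast hu
  nlinarith

/-! ### (5): the identity minimises Roy's ratio -/

section Five

variable {m : ℕ} {k : IntermediateField ℚ K} (η : Basis (Fin m) ℚ k) (hkF : k ≤ F)

/-- `ψ_K` is injective. [cite: Roy1992, §4 proof of Theorem 4 (p. 36)] -/
theorem psiK_injective : Function.Injective (psiK (d := d) η) := by
  rw [← LinearMap.ker_eq_bot, LinearMap.ker_eq_bot']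
  intro y hy
  exact psi_incl_eq_zero η hy

/-- The levels agree in `K^d`: `incl_F (ψ_F y) = ψ (incl_ℚ y)`. [folklore] -/
theorem incl_psiF (y : Fin (m * d) → ℚ) :
    incl F K d (psiF (d := d) η hkF y) = psi (fun μ => ((η μ : k) : K)) (incl ℚ K (m * d) y) := by
  funext i
  simp only [incl_apply, psiF_apply, psi_apply, map_sum, map_mul]
  rfl

/-- `incl_k (ψ_K y) = ψ (incl_ℚ y)`. [folklore] -/
theorem incl_psiK (y : Fin (m * d) → ℚ) :
    incl k K d (psiK (d := d) η y) = psi (fun μ => ((η μ : k) : K)) (incl ℚ K (m * d) y) := by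
  funext i
  simp only [incl_apply, psiK_apply, psi_apply, map_sum, map_mul]
  exact Finset.sum_congr rfl fun μ _ => rfl

/-- **`T = φ(S₀ × S₁)` is rational over `F`**: for `S₀ = ker A₀` (`A₀` over `F`) and `S₁ = ker A₁`
(`A₁` over `ℚ`), `φ(S₀ × S₁) = spanK_F (ker A₀ + span_F ψ_F(ker A₁))`.
[cite: Roy1992, §4 proof of Theorem 4 (p. 35)] -/
theorem map_phi_prod_eq_spanK {d₀' d₁' : ℕ} (A₀ : Matrix (Fin d₀') (Fin d) F)
    (A₁ : Matrix (Fin d₁') (Fin (m * d)) ℚ) :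
    ((LinearMap.ker (A₀.map (algebraMap F K)).mulVecLin).prod
        (LinearMap.ker (A₁.map (algebraMap ℚ K)).mulVecLin)).map (phi η) =
      spanK K (LinearMap.ker A₀.mulVecLin ⊔
        Submodule.span F (psiF η hkF '' (LinearMap.ker A₁.mulVecLin : Set (Fin (m * d) → ℚ)))) := by
  rw [ker_mulVecLin_map A₀, ker_mulVecLin_map A₁]
  apply le_antisymm
  · rw [Submodule.map_le_iff_le_comap]
    rintro ⟨x, y⟩ ⟨hx, hy⟩
    rw [Submodule.mem_comap, phi_apply]
    refine add_mem ?_ ?_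
    · exact Submodule.span_mono (Set.image_mono fun z hz => Submodule.mem_sup_left hz) hx
    · have hψy := Submodule.mem_map_of_mem (f := psi fun μ => ((η μ : k) : K)) hy
      rw [spanK, Submodule.map_span] at hψy
      refine Submodule.span_le.2 ?_ hψy
      rintro _ ⟨_, ⟨y₁, hy₁, rfl⟩, rfl⟩
      refine Submodule.subset_span ⟨psiF η hkF y₁, ?_, incl_psiF η hkF y₁⟩
      exact Submodule.mem_sup_right (Submodule.subset_span ⟨y₁, hy₁, rfl⟩)
  · rw [spanK, Submodule.span_le]
    rintro _ ⟨z, hz, rfl⟩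
    rw [SetLike.mem_coe] at hz ⊢
    obtain ⟨x₀, hx₀, w, hw, rfl⟩ := Submodule.mem_sup.1 hz
    rw [map_add]
    refine add_mem ?_ ?_
    · exact ⟨(incl F K d x₀, 0), ⟨Submodule.subset_span ⟨x₀, hx₀, rfl⟩, zero_mem _⟩, by simp⟩
    · refine Submodule.span_induction (p := fun w _ => incl F K d w ∈ _) ?_ (by simp)
        (fun a b _ _ ha hb => by simpa using add_mem ha hb) (fun c w _ hw => ?_) hw
      · rintro _ ⟨y₁, hy₁, rfl⟩
        refine ⟨(0, incl ℚ K (m * d) y₁), ⟨zero_mem _, Submodule.subset_span ⟨y₁, hy₁, rfl⟩⟩, ?_⟩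
        rw [phi_apply, zero_add, incl_psiF]
      · rw [LinearMap.map_smul, algebra_compatible_smul K c]
        exact Submodule.smul_mem _ _ hw

variable [FiniteDimensional ℚ k]

/-- **The count `dim_K(S₁) ≤ m dim_K(T)`**: if `K₁ ⊆ ℚ^{md}` is a `ℚ`-subspace with `ψ(K₁) ⊆ T` for
a `K`-subspace `T ⊆ K^d`, then `dim_ℚ K₁ ≤ m dim_K T` ("`dim_K(S₁) = dim_ℚ(S) = dim_ℚ(φ(0 × S))
≤ m dim_k(T ∩ k^d) ≤ m dim_K(T)`": `ψ_K` is injective, `ψ_K(K₁)` spans over `k` a subspace `R` of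
`k^d` with `dim_ℚ R = m dim_k R`, and `dim_k R = dim_K spanK R ≤ dim_K T`).
[cite: Roy1992, §4 proof of Theorem 4 (p. 36)] -/
theorem finrank_le_mul_finrank_of_psi_mem (K₁ : Submodule ℚ (Fin (m * d) → ℚ))
    (T : Submodule K (Fin d → K))
    (hT : ∀ y ∈ K₁, psi (fun μ => ((η μ : k) : K)) (incl ℚ K (m * d) y) ∈ T) :
    finrank ℚ K₁ ≤ m * finrank K T := by
  set R : Submodule k (Fin d → k) := Submodule.span k (psiK η '' K₁) with hR
  have h1 : finrank ℚ K₁ = finrank ℚ (K₁.map (psiK η)) :=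
    LinearEquiv.finrank_eq (Submodule.equivMapOfInjective _ (psiK_injective η) K₁)
  have h2 : K₁.map (psiK η) ≤ R.restrictScalars ℚ := by
    rw [Submodule.map_le_iff_le_comap]
    intro y hy
    exact Submodule.subset_span ⟨y, hy, rfl⟩
  have h3 : finrank ℚ (K₁.map (psiK η)) ≤ finrank ℚ (R.restrictScalars ℚ) :=
    Submodule.finrank_mono h2
  have h4 : finrank ℚ (R.restrictScalars ℚ) = m * finrank k R := by
    rw [((Submodule.restrictScalarsEquiv ℚ k (Fin d → k) R).restrictScalars ℚ).finrank_eq,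
      ← Module.finrank_mul_finrank ℚ k R, Module.finrank_eq_card_basis η, Fintype.card_fin]
  have h5 : finrank k R ≤ finrank K T := by
    rw [← finrank_spanK (K := K) R]
    refine Submodule.finrank_mono ?_
    rw [hR, spanK_span, Submodule.span_le]
    rintro _ ⟨_, ⟨y₁, hy₁, rfl⟩, rfl⟩
    rw [SetLike.mem_coe, incl_psiK]
    exact hT y₁ hy₁
  calc finrank ℚ K₁ = finrank ℚ (K₁.map (psiK η)) := h1
    _ ≤ finrank ℚ (R.restrictScalars ℚ) := h3
    _ = m * finrank k R := h4
    _ ≤ m * finrank K T := Nat.mul_le_mul_left m h5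

/-- The arithmetic of (5)–(6): from the counts of the proof of (5) — `u = dim U < d`,
`a = dim(U + T) < d`, `τ = dim T ≤ a`, `d₁ + τ = d`, `dim t₁(U) + τ = a`, (2) for `t₁`,
`d₁' + dim S₁ = md`, `dim S₁ ≤ mτ`, `dim s(V) + d = d₀' + d₁' + a`, `dim s(V) < d₀' + d₁'` — the
inequality `md/(d + md − (u + md)) ≤ d₁'/(d₀' + d₁' − dim s(V))`. [cite: Roy1992, §4 proof of Theorem 4, (5)–(6) (pp. 35–36)] -/
theorem ratio_le_of_counts {dd m d₀' d₁' u a τ κ₁ f₁ d₁ ms : ℕ} (hd : 0 < dd) (hu : u < dd)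
    (had : a < dd) (hτa : τ ≤ a) (hdim : d₁ + τ = dd) (hmapt₁ : f₁ + τ = a)
    (h2 : (u : ℝ) / dd ≤ (f₁ : ℝ) / d₁) (hd₁' : d₁' + κ₁ = m * dd) (hkey : κ₁ ≤ m * τ)
    (hmapsV : ms + dd = d₀' + d₁' + a) :
    ((m * dd : ℕ) : ℝ) / ((dd : ℝ) + ((m * dd : ℕ) : ℝ) - ((u + m * dd : ℕ) : ℝ)) ≤
      (d₁' : ℝ) / ((d₀' : ℝ) + d₁' - ms) := by
  have hdR : (0 : ℝ) < dd := by exact_mod_cast hd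
  have huR : (u : ℝ) < dd := by exact_mod_cast hu
  have haR : (a : ℝ) < dd := by exact_mod_cast had
  have hτR : (τ : ℝ) < dd := by exact_mod_cast lt_of_le_of_lt hτa had
  have hmR : (0 : ℝ) ≤ m := by exact_mod_cast Nat.zero_le m
  have hd₁R : (d₁ : ℝ) = dd - τ := by
    have : (d₁ : ℝ) + τ = dd := by exact_mod_cast hdim
    linarith
  have hft₁ : (f₁ : ℝ) = a - τ := by
    have : (f₁ : ℝ) + τ = a := by exact_mod_cast hmapt₁
    linarith
  rw [hd₁R, hft₁] at h2
  have hk : (u : ℝ) * (dd - τ) ≤ dd * (a - τ) := key_ineq hdR hτR h2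
  have hd₁'R : (m : ℝ) * (dd - τ) ≤ d₁' := by
    have h1 : (d₁' : ℝ) + κ₁ = m * dd := by exact_mod_cast hd₁'
    have h2' : (κ₁ : ℝ) ≤ m * τ := by exact_mod_cast hkey
    nlinarith
  have hden1 : (dd : ℝ) + ((m * dd : ℕ) : ℝ) - ((u + m * dd : ℕ) : ℝ) = dd - u := by
    push_cast
    ring
  have hden2 : (d₀' : ℝ) + d₁' - (ms : ℝ) = dd - a := by
    have : (ms : ℝ) + dd = d₀' + d₁' + a := by exact_mod_cast hmapsV
    linarith
  rw [hden1, hden2, div_le_div_iff₀ (by linarith) (by linarith)]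
  calc ((m * dd : ℕ) : ℝ) * (dd - a) ≤ (m : ℝ) * (dd - τ) * (dd - u) := by
        push_cast
        nlinarith [mul_nonneg hmR (sub_nonneg.2 hk)]
    _ ≤ (d₁' : ℝ) * (dd - u) := mul_le_mul_of_nonneg_right hd₁'R (by linarith)

include hkF in
/-- **(5) The identity minimises Roy's ratio.** With `V = φ⁻¹(U)`, `U ≠ K^d` satisfying (2): for
every admissible `s` with `s(V) ≠ K^{d₀'} × K^{d₁'}`,
`md/(d + md − dim_K V) ≤ d₁'/(d₀' + d₁' − dim_K s(V))`.
[cite: Roy1992, §4 proof of Theorem 4, (5)–(6) (pp. 35–36)] -/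
theorem thm2Ratio_id_le (hd : 0 < d) {U : Submodule K (Fin d → K)} (hU : U ≠ ⊤)
    (hmin : IsMinimalTwo F d U) {d₀' d₁' : ℕ}
    (s : LinTangent K d (m * d) →ₗ[K] LinTangent K d₀' d₁') (hs : IsAdmissible F s)
    (hsV : (U.comap (phi η)).map s ≠ ⊤) :
    thm2Ratio (U.comap (phi η)) d (m * d) LinearMap.id ≤ thm2Ratio (U.comap (phi η)) d₀' d₁' s := by
  -- `s = s₀ × s₁`, kernels and their dimensions
  obtain ⟨A₀, A₁, hsdec, hs₀, hs₁⟩ := exists_eq_prodMap_of_isAdmissible F hs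
  have hkers : LinearMap.ker s = (LinearMap.ker (A₀.map (algebraMap F K)).mulVecLin).prod
      (LinearMap.ker (A₁.map (algebraMap ℚ K)).mulVecLin) := by
    rw [hsdec, LinearMap.ker_prodMap]
  have hκ₀ : finrank K (LinearMap.ker (A₀.map (algebraMap F K)).mulVecLin) =
      finrank F (LinearMap.ker A₀.mulVecLin) := by rw [ker_mulVecLin_map, finrank_spanK]
  have hκ₁ : finrank K (LinearMap.ker (A₁.map (algebraMap ℚ K)).mulVecLin) =
      finrank ℚ (LinearMap.ker A₁.mulVecLin) := by rw [ker_mulVecLin_map, finrank_spanK]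
  have hd₀' : d₀' + finrank F (LinearMap.ker A₀.mulVecLin) = d := by
    have h := LinearMap.finrank_range_add_finrank_ker (A₀.map (algebraMap F K)).mulVecLin
    rwa [LinearMap.range_eq_top.2 hs₀, finrank_top, finrank_fin_fun, finrank_fin_fun, hκ₀] at h
  have hd₁' : d₁' + finrank ℚ (LinearMap.ker A₁.mulVecLin) = m * d := by
    have h := LinearMap.finrank_range_add_finrank_ker (A₁.map (algebraMap ℚ K)).mulVecLin
    rwa [LinearMap.range_eq_top.2 hs₁, finrank_top, finrank_fin_fun, finrank_fin_fun, hκ₁] at h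
  have hkerfin : finrank K (LinearMap.ker s) =
      finrank F (LinearMap.ker A₀.mulVecLin) + finrank ℚ (LinearMap.ker A₁.mulVecLin) := by
    rw [hkers, finrank_prod_eq, hκ₀, hκ₁]
  -- `T = φ(ker s)` is rational over `F`: `T = spanK TF`
  have hTeq : (LinearMap.ker s).map (phi η) = spanK K (LinearMap.ker A₀.mulVecLin ⊔
      Submodule.span F (psiF η hkF '' (LinearMap.ker A₁.mulVecLin : Set (Fin (m * d) → ℚ)))) := by
    rw [hkers, map_phi_prod_eq_spanK]
  -- a rational surjection `t₁` with kernel `T`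
  obtain ⟨d₁, A, hdim, hsurj, hkerA⟩ := exists_surjective_ker_eq_spanK (K := K)
    (LinearMap.ker A₀.mulVecLin ⊔
      Submodule.span F (psiF η hkF '' (LinearMap.ker A₁.mulVecLin : Set (Fin (m * d) → ℚ))))
  rw [← hTeq] at hkerA
  have hTfin : finrank K ((LinearMap.ker s).map (phi η)) = finrank F ↥(LinearMap.ker A₀.mulVecLin ⊔
      Submodule.span F (psiF η hkF '' (LinearMap.ker A₁.mulVecLin : Set (Fin (m * d) → ℚ)))) := by
    rw [hTeq, finrank_spanK]
  rw [← hTfin] at hdim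
  -- bookkeeping (6)
  have hVfin : finrank K (U.comap (phi η)) = finrank K U + m * d := by
    rw [finrank_comap_of_surjective _ (phi_surjective η), finrank_ker_phi]
  have hsupfin : finrank K ↥(U.comap (phi η) ⊔ LinearMap.ker s) =
      finrank K ↥(U ⊔ (LinearMap.ker s).map (phi η)) + m * d := by
    rw [comap_sup_eq_comap, finrank_comap_of_surjective _ (phi_surjective η), finrank_ker_phi]
  have hmaps := finrank_map_add_finrank_ker s (U.comap (phi η))
  rw [hkerfin, hsupfin] at hmaps
  have hmapsV : finrank K ((U.comap (phi η)).map s) + d =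
      d₀' + d₁' + finrank K ↥(U ⊔ (LinearMap.ker s).map (phi η)) := by
    omega
  have hlt : finrank K ((U.comap (phi η)).map s) < d₀' + d₁' := by
    have h := Submodule.finrank_lt hsV
    rw [Module.finrank_prod, finrank_fin_fun, finrank_fin_fun] at h
    exact h
  have had : finrank K ↥(U ⊔ (LinearMap.ker s).map (phi η)) < d := by omega
  have hτa : finrank K ((LinearMap.ker s).map (phi η)) ≤
      finrank K ↥(U ⊔ (LinearMap.ker s).map (phi η)) := Submodule.finrank_mono le_sup_right
  have hd₁pos : 0 < d₁ := by omega
  -- (2) for `t₁`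
  have hmapt₁ : finrank K (U.map (A.map (algebraMap F K)).mulVecLin) +
      finrank K ((LinearMap.ker s).map (phi η)) =
      finrank K ↥(U ⊔ (LinearMap.ker s).map (phi η)) := by
    have h := finrank_map_add_finrank_ker (A.map (algebraMap F K)).mulVecLin U
    rwa [hkerA] at h
  have h2 := hmin d₁ _ hsurj (isRationalMap_mulVecLin_map F A) (ne_zero_of_surjective hd₁pos hsurj)
  -- the count `dim_ℚ ker A₁ ≤ m dim T`
  have hkey : finrank ℚ (LinearMap.ker A₁.mulVecLin) ≤
      m * finrank K ((LinearMap.ker s).map (phi η)) := by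
    refine finrank_le_mul_finrank_of_psi_mem η _ _ fun y hy => ?_
    rw [← zero_add (psi _ _), ← phi_apply η (0, incl ℚ K (m * d) y)]
    refine Submodule.mem_map_of_mem ?_
    rw [hkers]
    exact ⟨zero_mem _, by rw [ker_mulVecLin_map]; exact Submodule.subset_span ⟨y, hy, rfl⟩⟩
  have hu' : finrank K U < d := by
    have h := Submodule.finrank_lt hU
    rw [finrank_fin_fun] at h
    exact h
  -- the final computation, in `ℝ`
  unfold thm2Ratio
  rw [Submodule.map_id, hVfin]
  exact ratio_le_of_counts hd hu' had hτa hdim hmapt₁ h2 hd₁' hkey hmapsV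

end Five

end Literature.NumberTheory.Transcendental.RoyRank
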